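import Mathlib
import Summits.Parity.GeneralizedHardyLittlewood.Theorems.FordMaynardSieveConst01651SieveConst01651HwtSplit

/-!
# Route `FordMaynardSieveConst01651`, target `SieveConst01651` (stmt-Parity-19185), line `sieve_decomposition`:
# helpers towards `stub_typeIIRegion` — re-indexing `n ↦ (n₁, n₂) = (smoothPart, roughPart)` with an `n`-dependent
# threshold

Ford–Maynard write every `n ∼ x` uniquely as `n = n₁ n₂`, `P⁺(n₁) ≤ n^σ < P⁻(n₂)` (here, with the tree's
convention, primes `< y(n)` into `n₁ = smoothPart`, primes `≥ y(n)` into `n₂ = roughPart`, `y(n) = n^ν`), and sum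
over the pairs `(n₁, n₂)`.  Because the threshold depends on `n = n₁ n₂` itself, the image of `n ↦ (n₁, n₂)` is
NOT a product set; this file records the re-indexing and the intrinsic description of the image:

* `sum_eq_sum_image_smoothRough` — `∑_{n ∈ S} G(n, n₁, n₂) = ∑_{(a,b) ∈ image} G(ab, a, b)` (`n ↦ (n₁,n₂)` is
  injective: `n₁ n₂ = n`);
* `mem_image_smoothRough_iff` — `(a, b)` is in the image iff `ab ∈ S`, every prime of `a` is `< y(ab)` and every
  prime of `b` is `≥ y(ab)`.

Divisors `u ∣ n₁`, `m ∣ n₂` with their cofactors are then plain `Nat.divisorsAntidiagonal` sums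
(`Nat.sum_divisorsAntidiagonal`).  Def-free. Nothing here proves anything about the Parity summit; helpers for the
Type-II region stub of one leaf.
-/

open Finset Literature.NumberTheory.Sieve Literature.NumberTheory.Sieve.FordMaynard Literature.Barriers.Parity

namespace Summit.Parity.GeneralizedHardyLittlewood.FordMaynardSieveConst01651SieveConst01651

/-- `n ↦ (n₁, n₂)` is injective (indeed `n₁ n₂ = n`). [folklore] -/
theorem smoothRough_injOn (y : ℕ → ℝ) (S : Finset ℕ) (hS : ∀ n ∈ S, n ≠ 0) :
    Set.InjOn (fun n => (smoothPart (y n) n, roughPart (y n) n)) S := by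
  intro n₁ h₁ n₂ h₂ heq
  simp only [Prod.mk.injEq] at heq
  rw [← roughPart_mul_smoothPart (y n₁) (hS n₁ h₁), ← roughPart_mul_smoothPart (y n₂) (hS n₂ h₂), heq.1, heq.2]

/-- **Re-indexing by the smooth/rough pair.** For `S` not containing `0` and any `G`,
`∑_{n ∈ S} G(n, n₁(n), n₂(n)) = ∑_{(a,b) ∈ S.image (n ↦ (n₁,n₂))} G(ab, a, b)`.
[cite: FordMaynard2024PrimeSieves, proof of Proposition 7.22 ("we write `n = n₁ n₂` with `P⁺(n₁) ≤ n^σ < P⁻(n₂)`")] -/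
theorem sum_eq_sum_image_smoothRough {M : Type*} [AddCommMonoid M] (y : ℕ → ℝ) (S : Finset ℕ)
    (hS : ∀ n ∈ S, n ≠ 0) (G : ℕ → ℕ → ℕ → M) :
    ∑ n ∈ S, G n (smoothPart (y n) n) (roughPart (y n) n) =
      ∑ ab ∈ S.image (fun n => (smoothPart (y n) n, roughPart (y n) n)), G (ab.1 * ab.2) ab.1 ab.2 := by
  classical
  rw [Finset.sum_image (smoothRough_injOn y S hS)]
  refine Finset.sum_congr rfl fun n hn => ?_
  simp only
  rw [mul_comm, roughPart_mul_smoothPart (y n) (hS n hn)]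

/-- **The image described intrinsically**: `(a, b) ∈ S.image (n ↦ (n₁, n₂))` iff `ab ∈ S`, all primes of `a` are
`< y(ab)` and all primes of `b` are `≥ y(ab)`. [cite: FordMaynard2024PrimeSieves, proof of Proposition 7.22] -/
theorem mem_image_smoothRough_iff (y : ℕ → ℝ) (S : Finset ℕ) (hS : ∀ n ∈ S, n ≠ 0) (a b : ℕ) :
    (a, b) ∈ S.image (fun n => (smoothPart (y n) n, roughPart (y n) n)) ↔
      a * b ∈ S ∧ (∀ p ∈ a.primeFactors, (p : ℝ) < y (a * b)) ∧ (∀ p ∈ b.primeFactors, y (a * b) ≤ (p : ℝ)) := by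
  classical
  rw [Finset.mem_image]
  constructor
  · rintro ⟨n, hn, heq⟩
    simp only [Prod.mk.injEq] at heq
    obtain ⟨ha, hb⟩ := heq
    have hn0 := hS n hn
    have hprod : a * b = n := by rw [← ha, ← hb, mul_comm, roughPart_mul_smoothPart (y n) hn0]
    rw [hprod]
    refine ⟨hn, fun p hp => ?_, fun p hp => ?_⟩
    · rw [← ha] at hp; exact lt_of_mem_primeFactors_smoothPart hn0 hp
    · rw [← hb] at hp; exact le_of_mem_primeFactors_roughPart hp
  · rintro ⟨hab, hsmooth, hrough⟩
    have hab0 : a * b ≠ 0 := hS _ hab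
    have ha0 : a ≠ 0 := left_ne_zero_of_mul hab0
    have hb0 : b ≠ 0 := right_ne_zero_of_mul hab0
    refine ⟨a * b, hab, ?_⟩
    simp only [Prod.mk.injEq]
    exact ⟨smoothPart_mul_of_smooth_rough ha0 hb0 hsmooth hrough,
      roughPart_mul_of_smooth_rough ha0 hb0 hsmooth hrough⟩

/-- The image consists of pairs of positive integers. [folklore] -/
theorem ne_zero_of_mem_image_smoothRough (y : ℕ → ℝ) (S : Finset ℕ) (hS : ∀ n ∈ S, n ≠ 0) {a b : ℕ}
    (h : (a, b) ∈ S.image (fun n => (smoothPart (y n) n, roughPart (y n) n))) : a ≠ 0 ∧ b ≠ 0 := by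
  have hab := ((mem_image_smoothRough_iff y S hS a b).mp h).1
  have hab0 : a * b ≠ 0 := hS _ hab
  exact ⟨left_ne_zero_of_mul hab0, right_ne_zero_of_mul hab0⟩

/-- **The expansion of `∑_n w(n) H(n)` over the pairs** (combining `…HwtSplit.Hwt_eq_sum_smooth_rough` with the
re-indexing): for `S ∌ 0`,
`∑_{n ∈ S} w(n) H(n) = ∑_{(a,b)} w(ab) ∑_{u ∣ a} ∑_{m ∣ b} 𝟙[u m ≤ (ab)^{1/2}] μ(u) g(𝐯(m; ab))`.
[cite: FordMaynard2024PrimeSieves, proof of Proposition 7.22 (expansion of `H(n)`)] -/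
theorem sum_mul_Hwt_eq_sum_image (g : VecFn) (ν : ℝ) (S : Finset ℕ)
    (hS : ∀ n ∈ S, n ≠ 0) (w : ℕ → ℝ) :
    ∑ n ∈ S, w n * Hwt g ν n =
      ∑ ab ∈ S.image (fun n : ℕ => (smoothPart ((n : ℝ) ^ ν) n, roughPart ((n : ℝ) ^ ν) n)),
        w (ab.1 * ab.2) * ∑ u ∈ ab.1.divisors, ∑ m ∈ ab.2.divisors,
          if ((u * m : ℕ) : ℝ) ≤ ((ab.1 * ab.2 : ℕ) : ℝ) ^ (1 / 2 : ℝ) then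
            ((ArithmeticFunction.moebius u : ℤ) : ℝ) * g _ (pvec (ab.1 * ab.2) m) else 0 := by
  have h := sum_eq_sum_image_smoothRough (fun n : ℕ => (n : ℝ) ^ ν) S hS
    (fun n a b => w n * ∑ u ∈ a.divisors, ∑ m ∈ b.divisors,
      if ((u * m : ℕ) : ℝ) ≤ (n : ℝ) ^ (1 / 2 : ℝ) then
        ((ArithmeticFunction.moebius u : ℤ) : ℝ) * g _ (pvec n m) else 0)
  rw [← h]
  refine Finset.sum_congr rfl fun n hn => ?_
  rw [Hwt_eq_sum_smooth_rough g ν (hS n hn)]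

end Summit.Parity.GeneralizedHardyLittlewood.FordMaynardSieveConst01651SieveConst01651
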